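import Literature.Analysis.FluidPDE.OseenDuhamelEnvelopeCalculus
import Literature.Analysis.FluidPDE.PeriodicBoundedMildMean
import HarnessLib

/-!
# The Duhamel term of periodic fields under a slice-wise envelope has zero cell average

Analysis/FluidPDE support file (everything proved) for the perturbation step of M. P. Coiculescu,
S. Palasek, *Non-uniqueness of smooth solutions of the Navier–Stokes equations from critical data*,
Invent. Math. 244 (2025) = arXiv:2503.14699, §5: the correction `w` of Prop. 4.3 has zero average
on `𝕋³` (it is a sum of Duhamel terms `B¹_0(a,b)(t) = ∫₀ᵗ e^{(t-τ)Δ}ℙ∇·(a⊗b)` — derivatives — of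
periodic fields; the principal parts have zero average by Def. 3.10/Rmk. 3.11, so the solutions
`u⁽ⁱ⁾` are mean zero, as used by the global continuation of §5). The tree's
`Torus.integral_oseenDuhamel_repr_eq_zero` is the bounded diagonal case; here the fields are a
pair with time-singular envelopes (`‖v(τ)‖ ≲ τ^{-1/2}`, `‖w(τ)‖ ≲ τ^{α-1/2}`, `‖F(τ)‖ ≲ τ^{α-1}`):

* `Torus.integral_oseenDuhamel_repr_eq_zero_of_envelope` — for jointly measurable `a, b` whose
  slices on `(t₀, t)` are lifts of continuous torus fields, with `‖a τ y‖ ≤ M_a(τ)`,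
  `‖b τ y‖ ≤ M_b(τ)` and `(t-τ)^{-1/2}M_aM_b` integrable, `∫_{𝕋ᵈ} B¹_{t₀}(a,b)(t)(repr x) dx = 0`
  (Fubini over `𝕋ᵈ × (t₀,t)`, and `Torus.integral_oseenSlice_lift_repr_eq_zero` slice by slice).

## References

* M. P. Coiculescu, S. Palasek, Invent. Math. 244 (2025) = arXiv:2503.14699, Prop. 4.3, Def. 3.10,
  Rmk. 3.11, §5. [`CoiculescuPalasek2025`]
* G. Koch, N. Nadirashvili, G. Seregin, V. Šverák, Acta Math. 203 (2009) = arXiv:0709.3599, §3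
  p. 6. [`KochNadirashviliSereginSverak2009`]
-/

noncomputable section

open MeasureTheory Set Function Filter TopologicalSpace InnerProductSpace Metric
open Literature.Analysis.FunctionSpaces
open _root_.Topology
open scoped RealInnerProductSpace NNReal ENNReal

namespace Literature.Analysis.FluidPDE

namespace Torus

variable {d : Type*} [Fintype d]

/-- **The Duhamel term of periodic fields under an envelope has zero cell average.** For jointly
measurable `a, b : ℝ → ℝᵈ → ℝᵈ` whose slices on `(t₀, t)` are lifts of continuous torus fields,
with `‖a τ y‖ ≤ M_a(τ)`, `‖b τ y‖ ≤ M_b(τ)` on `(t₀,t)` and `(t-τ)^{-1/2}M_a(τ)M_b(τ)` integrable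
there, `∫_{𝕋ᵈ} B¹_{t₀}(a, b)(t)(repr x) dx = 0` (Fubini in `(x, τ)` under
`‖N_{t-τ}[a,b]‖ ≤ C₀(t-τ)^{-1/2}M_aM_b`, and the slices have zero average). [cite: KochNadirashviliSereginSverak2009, §3 p. 6 (arXiv:0709.3599v1); CoiculescuPalasek2025, §5] -/
theorem integral_oseenDuhamel_repr_eq_zero_of_envelope
    {a b : ℝ → EuclideanSpace ℝ d → EuclideanSpace ℝ d}
    {A B : ℝ → UnitAddTorus d → EuclideanSpace ℝ d} {t₀ t : ℝ} {Ma Mb : ℝ → ℝ}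
    (ham : Measurable (uncurry a)) (hbm : Measurable (uncurry b))
    (ha : ∀ τ ∈ Ioo t₀ t, ∀ y, ‖a τ y‖ ≤ Ma τ) (hb : ∀ τ ∈ Ioo t₀ t, ∀ y, ‖b τ y‖ ≤ Mb τ)
    (henv : IntegrableOn (fun τ => (t - τ) ^ (-(1 / 2 : ℝ)) * (Ma τ * Mb τ)) (Ioo t₀ t))
    (hA : ∀ τ ∈ Ioo t₀ t, Continuous (A τ)) (hB : ∀ τ ∈ Ioo t₀ t, Continuous (B τ))
    (hlifta : ∀ τ ∈ Ioo t₀ t, Torus.lift (A τ) = a τ) (hliftb : ∀ τ ∈ Ioo t₀ t, Torus.lift (B τ) = b τ) :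
    ∫ x, oseenDuhamel 1 t₀ a b t (Torus.repr x) = 0 := by
  simp_rw [oseenDuhamel_one_eq_setIntegral_oseenSlice]
  -- Fubini over `𝕋ᵈ × (t₀, t)`
  have hint : Integrable (uncurry fun (x : UnitAddTorus d) (σ : ℝ) =>
      oseenSlice (t - σ) (a σ) (b σ) (Torus.repr x)) (volume.prod (volume.restrict (Ioo t₀ t))) := by
    refine Integrable.mono'
      (g := fun p => (1 : ℝ) * (oseenSliceConst (EuclideanSpace ℝ d) *
        ((t - p.2) ^ (-(1 / 2 : ℝ)) * (Ma p.2 * Mb p.2))))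
      ((integrable_const (1 : ℝ)).mul_prod (henv.const_mul _)) ?_ ?_
    · have hsm := stronglyMeasurable_oseenSlice_duhamel 1 t ham hbm
      have h2 := (hsm.comp_measurable
        (measurable_snd.prodMk (Torus.measurable_repr.comp measurable_fst))).aestronglyMeasurable
        (μ := (volume : Measure (UnitAddTorus d)).prod (volume.restrict (Ioo t₀ t)))
      refine h2.congr (Eventually.of_forall fun p => ?_)
      simp only [uncurry, Function.comp_apply, one_mul]
    · have hmem : ∀ᵐ p ∂((volume : Measure (UnitAddTorus d)).prod (volume.restrict (Ioo t₀ t))),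
          p.2 ∈ Ioo t₀ t := by
        have hre : (volume : Measure (UnitAddTorus d)).prod (volume.restrict (Ioo t₀ t)) =
            ((volume : Measure (UnitAddTorus d)).prod volume).restrict (univ ×ˢ Ioo t₀ t) := by
          rw [← Measure.prod_restrict, Measure.restrict_univ]
        rw [hre]
        filter_upwards [ae_restrict_mem (MeasurableSet.univ.prod measurableSet_Ioo)] with p hp
        exact (mem_prod.1 hp).2
      filter_upwards [hmem] with p hp
      have hσ : 0 < t - p.2 := sub_pos.2 hp.2
      calc ‖uncurry (fun (x : UnitAddTorus d) (σ : ℝ) =>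
              oseenSlice (t - σ) (a σ) (b σ) (Torus.repr x)) p‖
          ≤ oseenSliceConst (EuclideanSpace ℝ d) * (t - p.2) ^ (-(1 / 2 : ℝ)) * Ma p.2 * Mb p.2 :=
            norm_oseenSlice_le_oseenSliceConst hσ (ha p.2 hp) (hb p.2 hp) _
        _ = 1 * (oseenSliceConst (EuclideanSpace ℝ d) *
              ((t - p.2) ^ (-(1 / 2 : ℝ)) * (Ma p.2 * Mb p.2))) := by ring
  rw [integral_integral_swap hint]
  refine (setIntegral_congr_fun measurableSet_Ioo fun σ hσ => ?_).trans (integral_zero _ _)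
  rw [← hlifta σ hσ, ← hliftb σ hσ]
  exact integral_oseenSlice_lift_repr_eq_zero (hA σ hσ) (hB σ hσ) (sub_pos.2 hσ.2)

end Torus

end Literature.Analysis.FluidPDE
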